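import Literature.Topology.FourManifolds.LevelTorusFibrewise
import HarnessLib

/-!
# The model vector of the polar tube attached to tube coordinates `(u, y) ∈ 𝕊¹ × ℝ³`

Auxiliary file (part 1 of 2) of helper `helper_bott_model` of stub
`helper_sliceGluing_bottRecognition` (fibred Morse–Bott recognition of the polar tube), line
`Sketch`, crux `SblfDescent.RungOne`.

(Crux item stmt-SmoothPoincare4-18531; skeleton `Cruxes/RungOne/Lines/Sketch.lean`.)

Let `X` be a smooth `4`-manifold, `F : X → ℝ` smooth with regular level `a < b`, and
`β : X → ℝ²`.  Suppose the superlevel set `V = {a ≤ F}` is globally parametrised by a tube: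
a smooth map `Ν : 𝕊¹ × ℝ³ → X` and a map `Νinv : X → 𝕊¹ × ℝ³` with, for `‖y‖ ≤ √(b - a)`,
`F (Ν (u, y)) = b - ‖y‖²`, `β (Ν (u, y)) = u`, `Νinv (Ν (u, y)) = (u, y)`, and such that every
point of `V` is some `Ν (u, y)` with `‖y‖ ≤ √(b - a)` and `Νinv` is smooth at the points of `V`.
Then `V` (the compact `4`-manifold with boundary `Literature.Topology.FourManifolds.RegularSuperlevel`)
is diffeomorphic to the polar tube `V₀ = {x₃² + x₄² ≥ 1/2}` of the level `4`-sphere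
(`Literature.Topology.FourManifolds.SphereFourSplitting.PolarTube`), by the explicit map
`Ν (u, y) ↦ (y / √(2(b - a)), √(1 - ‖y‖² / (2 (b - a))) · u)`, which sends the level `F = a`
to the boundary `{x₃² + x₄² = 1/2}` and whose polar coordinates `(x₃, x₄)` are a positive
multiple of `β`.  This is the bookkeeping step "`S¹ × D³ ≅ V₀`" of the recognition of a
Morse–Bott tube about a maximum circle (Milnor 1963, Thm. 3.1 for the regular-domain
structures; Lee 2013, Cor. 5.30 for smoothness into regular domains).

## References

* J. Milnor, *Morse theory*, Ann. of Math. Studies 51 (1963), Thm. 3.1. [Milnor1963]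
* J. M. Lee, *Introduction to Smooth Manifolds*, 2nd ed. (2013), Cor. 5.30. [LeeSmoothManifolds2013]
-/

set_option linter.dupNamespace false

noncomputable section

open scoped Manifold ContDiff Topology
open Set Function Metric Module Literature.Topology.FourManifolds
  Literature.Topology.FourManifolds.SphereFourSplitting

namespace Summit.SmoothPoincare4.SmoothPoincare4.Cruxes.RungOne.Sketch

namespace BottModel

/-! ### The model vector -/

/-- The scale `c = 1 / √(2 (b - a))` of the model map. [folklore] -/
def scale (a b : ℝ) : ℝ := (√(2 * (b - a)))⁻¹

/-- The polar radius `s = √(1 - c² ‖y‖²)` of the model map. [folklore] -/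
def rad (a b : ℝ) (y : EuclideanSpace ℝ (Fin 3)) : ℝ := √(1 - scale a b ^ 2 * ‖y‖ ^ 2)

/-- **The model vector** `(c y, s u) ∈ ℝ⁵` attached to `(u, y) ∈ ℝ² × ℝ³`. [folklore] -/
def vec (a b : ℝ) (u : EuclideanSpace ℝ (Fin 2)) (y : EuclideanSpace ℝ (Fin 3)) :
    EuclideanSpace ℝ (Fin 5) :=
  (EuclideanSpace.equiv (Fin 5) ℝ).symm
    ![scale a b * y 0, scale a b * y 1, scale a b * y 2, rad a b y * u 0, rad a b y * u 1]

/-- Coordinate formula (definitional unfolding). [folklore] -/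
@[simp] theorem vec_apply_zero (a b : ℝ) (u : EuclideanSpace ℝ (Fin 2)) (y : EuclideanSpace ℝ (Fin 3)) :
    vec a b u y 0 = scale a b * y 0 := rfl
/-- Coordinate formula (definitional unfolding). [folklore] -/
@[simp] theorem vec_apply_one (a b : ℝ) (u : EuclideanSpace ℝ (Fin 2)) (y : EuclideanSpace ℝ (Fin 3)) :
    vec a b u y 1 = scale a b * y 1 := rfl
/-- Coordinate formula (definitional unfolding). [folklore] -/
@[simp] theorem vec_apply_two (a b : ℝ) (u : EuclideanSpace ℝ (Fin 2)) (y : EuclideanSpace ℝ (Fin 3)) :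
    vec a b u y 2 = scale a b * y 2 := rfl
/-- Coordinate formula (definitional unfolding). [folklore] -/
@[simp] theorem vec_apply_three (a b : ℝ) (u : EuclideanSpace ℝ (Fin 2)) (y : EuclideanSpace ℝ (Fin 3)) :
    vec a b u y 3 = rad a b y * u 0 := rfl
/-- Coordinate formula (definitional unfolding). [folklore] -/
@[simp] theorem vec_apply_four (a b : ℝ) (u : EuclideanSpace ℝ (Fin 2)) (y : EuclideanSpace ℝ (Fin 3)) :
    vec a b u y 4 = rad a b y * u 1 := rfl

variable {a b : ℝ}

/-- `c > 0`. [folklore] -/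
theorem scale_pos (hab : a < b) : 0 < scale a b :=
  inv_pos.2 (Real.sqrt_pos.2 (by linarith))

/-- `c² · 2 (b - a) = 1`. [folklore] -/
theorem scale_sq_mul (hab : a < b) : scale a b ^ 2 * (2 * (b - a)) = 1 := by
  rw [scale, inv_pow, Real.sq_sqrt (by linarith)]
  field_simp
  exact div_self (by linarith)

/-- `√(2 (b - a)) · c = 1`. [folklore] -/
theorem sqrt_mul_scale (hab : a < b) : √(2 * (b - a)) * scale a b = 1 := by
  rw [scale, mul_inv_cancel₀ (Real.sqrt_pos.2 (by linarith)).ne']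

/-- For `‖y‖ ≤ √(b - a)`: `c² ‖y‖² ≤ 1/2`. [folklore] -/
theorem scale_sq_norm_sq_le (hab : a < b) {y : EuclideanSpace ℝ (Fin 3)} (hy : ‖y‖ ≤ √(b - a)) :
    scale a b ^ 2 * ‖y‖ ^ 2 ≤ 1 / 2 := by
  have h1 : ‖y‖ ^ 2 ≤ b - a := by
    calc ‖y‖ ^ 2 ≤ (√(b - a)) ^ 2 := pow_le_pow_left₀ (norm_nonneg _) hy 2
      _ = b - a := Real.sq_sqrt (by linarith)
  have h2 := scale_sq_mul hab
  have h3 : 0 ≤ scale a b ^ 2 := sq_nonneg _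
  nlinarith

/-- For `‖y‖ ≤ √(b - a)`: `1/2 ≤ 1 - c² ‖y‖²`. [folklore] -/
theorem half_le_one_sub (hab : a < b) {y : EuclideanSpace ℝ (Fin 3)} (hy : ‖y‖ ≤ √(b - a)) :
    1 / 2 ≤ 1 - scale a b ^ 2 * ‖y‖ ^ 2 := by
  have := scale_sq_norm_sq_le hab hy
  linarith

/-- For `‖y‖ ≤ √(b - a)`: `s² = 1 - c² ‖y‖²`. [folklore] -/
theorem rad_sq (hab : a < b) {y : EuclideanSpace ℝ (Fin 3)} (hy : ‖y‖ ≤ √(b - a)) :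
    rad a b y ^ 2 = 1 - scale a b ^ 2 * ‖y‖ ^ 2 :=
  Real.sq_sqrt (by have := half_le_one_sub hab hy; linarith)

/-- For `‖y‖ ≤ √(b - a)`: `s > 0`. [folklore] -/
theorem rad_pos (hab : a < b) {y : EuclideanSpace ℝ (Fin 3)} (hy : ‖y‖ ≤ √(b - a)) :
    0 < rad a b y :=
  Real.sqrt_pos.2 (by have := half_le_one_sub hab hy; linarith)

/-- **The model vector lies on the unit sphere**: `N (c y, s u) = 1` for `‖u‖ = 1`,
`‖y‖ ≤ √(b - a)`. [folklore] -/
theorem sqNorm_vec (hab : a < b) {u : EuclideanSpace ℝ (Fin 2)} (hu : ‖u‖ = 1)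
    {y : EuclideanSpace ℝ (Fin 3)} (hy : ‖y‖ ≤ √(b - a)) : sqNorm (vec a b u y) = 1 := by
  have h1 := rad_sq hab hy
  have h2 : u 0 ^ 2 + u 1 ^ 2 = 1 := by
    have h := EuclideanSpace.norm_sq_eq u
    rw [hu, Fin.sum_univ_two] at h
    simp only [Real.norm_eq_abs, sq_abs, one_pow] at h
    linarith
  have h3 : ‖y‖ ^ 2 = y 0 ^ 2 + y 1 ^ 2 + y 2 ^ 2 := by
    rw [EuclideanSpace.norm_sq_eq, Fin.sum_univ_three]
    simp [Real.norm_eq_abs, sq_abs]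
  simp only [sqNorm, vec_apply_zero, vec_apply_one, vec_apply_two, vec_apply_three, vec_apply_four]
  nlinarith

/-- **The tube function of the model vector**: `u (c y, s u) = 1 - c² ‖y‖²`. [folklore] -/
theorem tubeFn_vec (hab : a < b) {u : EuclideanSpace ℝ (Fin 2)} (hu : ‖u‖ = 1)
    {y : EuclideanSpace ℝ (Fin 3)} (hy : ‖y‖ ≤ √(b - a)) :
    tubeFn (vec a b u y) = 1 - scale a b ^ 2 * ‖y‖ ^ 2 := by
  have h1 := rad_sq hab hy
  have h2 : u 0 ^ 2 + u 1 ^ 2 = 1 := by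
    have h := EuclideanSpace.norm_sq_eq u
    rw [hu, Fin.sum_univ_two] at h
    simp only [Real.norm_eq_abs, sq_abs, one_pow] at h
    linarith
  simp only [tubeFn, vec_apply_three, vec_apply_four]
  nlinarith

/-- The model vector has `u ≥ 1/2`, i.e. lies over the polar tube. [folklore] -/
theorem half_le_tubeFn_vec (hab : a < b) {u : EuclideanSpace ℝ (Fin 2)} (hu : ‖u‖ = 1)
    {y : EuclideanSpace ℝ (Fin 3)} (hy : ‖y‖ ≤ √(b - a)) : 1 / 2 ≤ tubeFn (vec a b u y) := by
  rw [tubeFn_vec hab hu hy]; exact half_le_one_sub hab hy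

/-- `head3 (c y, s u) = c • y`. [folklore] -/
theorem head3_vec (u : EuclideanSpace ℝ (Fin 2)) (y : EuclideanSpace ℝ (Fin 3)) :
    head3 (vec a b u y) = scale a b • y := by
  refine euclidean_ext fun i => ?_
  fin_cases i <;> simp [head3]

/-- The model vector is a point of the unit sphere of `ℝ⁵`. [folklore] -/
theorem vec_mem_sphere (hab : a < b) {u : EuclideanSpace ℝ (Fin 2)} (hu : ‖u‖ = 1)
    {y : EuclideanSpace ℝ (Fin 3)} (hy : ‖y‖ ≤ √(b - a)) :
    vec a b u y ∈ Metric.sphere (0 : EuclideanSpace ℝ (Fin 5)) 1 := by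
  have h := sqNorm_vec hab hu hy
  rw [sqNorm_eq_norm_sq] at h
  rw [mem_sphere_zero_iff_norm]
  nlinarith [norm_nonneg (vec a b u y)]


/-! ### Points of the polar tube from `(u, y)` -/

/-- `XV` is injective (two inclusions of subtypes). [folklore] -/
theorem XV_injective : Injective (XV : PolarTube → EuclideanSpace ℝ (Fin 5)) := fun _ _ h =>
  RegularSublevel.injective_incl hPolar (Subtype.ext h)

/-- The norm of a point of the unit circle is `1`. [folklore] -/
theorem norm_coe_circle (u : Metric.sphere (0 : EuclideanSpace ℝ (Fin 2)) 1) :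
    ‖(u : EuclideanSpace ℝ (Fin 2))‖ = 1 :=
  mem_sphere_zero_iff_norm.1 u.2

/-- The point of the level sphere `S` with position vector the model vector. [folklore] -/
def ptS (hab : a < b) (u : Metric.sphere (0 : EuclideanSpace ℝ (Fin 2)) 1)
    (y : EuclideanSpace ℝ (Fin 3)) (hy : ‖y‖ ≤ √(b - a)) : LevelSphere :=
  sphereLevelDiffeomorph.symm ⟨vec a b u y, vec_mem_sphere hab (norm_coe_circle u) hy⟩

/-- `ι (ptS u y) = vec u y`. [folklore] -/
@[simp] theorem ι_ptS (hab : a < b) (u : Metric.sphere (0 : EuclideanSpace ℝ (Fin 2)) 1)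
    (y : EuclideanSpace ℝ (Fin 3)) (hy : ‖y‖ ≤ √(b - a)) :
    ι (ptS hab u y hy) = vec a b u y := by
  have h := coe_sphereLevelDiffeomorph (sphereLevelDiffeomorph.symm
    ⟨vec a b u y, vec_mem_sphere hab (norm_coe_circle u) hy⟩)
  rw [Diffeomorph.apply_symm_apply] at h
  rw [ptS, ← h]

/-- `tubeS (ptS u y) = 1 - c² ‖y‖²`. [folklore] -/
theorem tubeS_ptS (hab : a < b) (u : Metric.sphere (0 : EuclideanSpace ℝ (Fin 2)) 1)
    (y : EuclideanSpace ℝ (Fin 3)) (hy : ‖y‖ ≤ √(b - a)) :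
    tubeS (ptS hab u y hy) = 1 - scale a b ^ 2 * ‖y‖ ^ 2 := by
  rw [tubeS, ι_ptS, tubeFn_vec hab (norm_coe_circle u) hy]

/-- **The point of the polar tube `V₀` attached to `(u, y)`**, `‖y‖ ≤ √(b - a)`. [folklore] -/
def ptV (hab : a < b) (u : Metric.sphere (0 : EuclideanSpace ℝ (Fin 2)) 1)
    (y : EuclideanSpace ℝ (Fin 3)) (hy : ‖y‖ ≤ √(b - a)) : PolarTube :=
  RegularSublevel.mk hPolar (ptS hab u y hy)
    (show (1 : ℝ) / 2 - tubeS (ptS hab u y hy) ≤ 0 by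
      rw [tubeS_ptS]; have := half_le_one_sub hab hy; linarith)

/-- `XV (ptV u y) = vec u y`. [folklore] -/
@[simp] theorem XV_ptV (hab : a < b) (u : Metric.sphere (0 : EuclideanSpace ℝ (Fin 2)) 1)
    (y : EuclideanSpace ℝ (Fin 3)) (hy : ‖y‖ ≤ √(b - a)) :
    XV (ptV hab u y hy) = vec a b u y :=
  ι_ptS hab u y hy

/-- `tubeS (ιV (ptV u y)) = 1 - c² ‖y‖²`. [folklore] -/
theorem tubeS_ιV_ptV (hab : a < b) (u : Metric.sphere (0 : EuclideanSpace ℝ (Fin 2)) 1)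
    (y : EuclideanSpace ℝ (Fin 3)) (hy : ‖y‖ ≤ √(b - a)) :
    tubeS (ιV (ptV hab u y hy)) = 1 - scale a b ^ 2 * ‖y‖ ^ 2 :=
  tubeS_ptS hab u y hy

/-- `tubeFn (vec u y) = s²`. [folklore] -/
theorem tubeFn_vec_eq_rad_sq (hab : a < b) (u : Metric.sphere (0 : EuclideanSpace ℝ (Fin 2)) 1)
    {y : EuclideanSpace ℝ (Fin 3)} (hy : ‖y‖ ≤ √(b - a)) :
    tubeFn (vec a b u y) = rad a b y ^ 2 := by
  rw [tubeFn_vec hab (norm_coe_circle u) hy, rad_sq hab hy]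

/-- **The base direction of `ptV u y` is `u`.** [folklore] -/
theorem uV_ptV (hab : a < b) (u : Metric.sphere (0 : EuclideanSpace ℝ (Fin 2)) 1)
    (y : EuclideanSpace ℝ (Fin 3)) (hy : ‖y‖ ≤ √(b - a)) : uV (ptV hab u y hy) = u := by
  apply Subtype.ext
  rw [coe_uV]
  have hr := rad_pos hab hy
  have hs : (√(tubeFn (XV (ptV hab u y hy))))⁻¹ * rad a b y = 1 := by
    rw [XV_ptV, tubeFn_vec_eq_rad_sq hab u hy, Real.sqrt_sq hr.le, inv_mul_cancel₀ hr.ne']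
  refine euclidean_ext fun i => ?_
  fin_cases i
  · show (√(tubeFn (XV (ptV hab u y hy))))⁻¹ * XV (ptV hab u y hy) 3 = (u : EuclideanSpace ℝ (Fin 2)) 0
    rw [XV_ptV, vec_apply_three, ← XV_ptV hab u y hy, ← mul_assoc, hs, one_mul]
  · show (√(tubeFn (XV (ptV hab u y hy))))⁻¹ * XV (ptV hab u y hy) 4 = (u : EuclideanSpace ℝ (Fin 2)) 1
    rw [XV_ptV, vec_apply_four, ← XV_ptV hab u y hy, ← mul_assoc, hs, one_mul]

/-- **The head of `ptV u y` rescaled is `y`**: `√(2 (b - a)) • head3 (XV (ptV u y)) = y`. [folklore] -/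
theorem smul_head3_XV_ptV (hab : a < b) (u : Metric.sphere (0 : EuclideanSpace ℝ (Fin 2)) 1)
    (y : EuclideanSpace ℝ (Fin 3)) (hy : ‖y‖ ≤ √(b - a)) :
    √(2 * (b - a)) • head3 (XV (ptV hab u y hy)) = y := by
  rw [XV_ptV, head3_vec, smul_smul, sqrt_mul_scale hab, one_smul]

/-! ### The backward vector `√(2 (b - a)) • head3 (XV q)` -/

/-- `‖head3 (XV q)‖² = 1 - u(XV q) ≤ 1/2` on the polar tube. [folklore] -/
theorem norm_head3_XV_sq (q : PolarTube) : ‖head3 (XV q)‖ ^ 2 = 1 - tubeFn (XV q) := by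
  have h := sqNorm_eq_head_add_tube (XV q)
  rw [sqNorm_ι] at h
  linarith

/-- **The backward vector has norm at most `√(b - a)`.** [folklore] -/
theorem norm_backVec_le (hab : a < b) (q : PolarTube) :
    ‖√(2 * (b - a)) • head3 (XV q)‖ ≤ √(b - a) := by
  have h1 := norm_head3_XV_sq q
  have h2 := half_le_tubeS_ιV q
  rw [tubeS] at h2
  have h3 : ‖√(2 * (b - a)) • head3 (XV q)‖ ^ 2 ≤ b - a := by
    rw [norm_smul, mul_pow, Real.norm_eq_abs, sq_abs, Real.sq_sqrt (by linarith), h1]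
    change 2 * (b - a) * (1 - tubeFn (ι (ιV q))) ≤ b - a
    nlinarith
  calc ‖√(2 * (b - a)) • head3 (XV q)‖ = √(‖√(2 * (b - a)) • head3 (XV q)‖ ^ 2) :=
        (Real.sqrt_sq (norm_nonneg _)).symm
    _ ≤ √(b - a) := Real.sqrt_le_sqrt h3

/-- `‖√(2 (b - a)) • head3 (XV q)‖² = 2 (b - a) (1 - u)`. [folklore] -/
theorem norm_backVec_sq (hab : a < b) (q : PolarTube) :
    ‖√(2 * (b - a)) • head3 (XV q)‖ ^ 2 = 2 * (b - a) * (1 - tubeFn (XV q)) := by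
  rw [norm_smul, mul_pow, Real.norm_eq_abs, sq_abs, Real.sq_sqrt (by linarith), norm_head3_XV_sq]

/-- **Reconstruction**: `vec (uV q) (√(2 (b - a)) • head3 (XV q)) = XV q`. [folklore] -/
theorem vec_uV_backVec (hab : a < b) (q : PolarTube) :
    vec a b (uV q) (√(2 * (b - a)) • head3 (XV q)) = XV q := by
  have hc := sqrt_mul_scale hab
  have hu := tubeFn_XV_pos q
  have hrad : rad a b (√(2 * (b - a)) • head3 (XV q)) = √(tubeFn (XV q)) := by
    rw [rad, norm_backVec_sq hab, ← mul_assoc, scale_sq_mul hab, one_mul]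
    congr 1; ring
  have hs : √(tubeFn (XV q)) * (√(tubeFn (XV q)))⁻¹ = 1 := mul_inv_cancel₀ (Real.sqrt_pos.2 hu).ne'
  have hci : ∀ t : ℝ, scale a b * (√(2 * (b - a)) * t) = t := fun t => by
    rw [← mul_assoc, mul_comm (scale a b), hc, one_mul]
  refine euclidean_ext fun i => ?_
  fin_cases i
  · show scale a b * (√(2 * (b - a)) • head3 (XV q)) 0 = XV q 0
    rw [PiLp.smul_apply, smul_eq_mul, head3_apply_zero, hci]
  · show scale a b * (√(2 * (b - a)) • head3 (XV q)) 1 = XV q 1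
    rw [PiLp.smul_apply, smul_eq_mul, head3_apply_one, hci]
  · show scale a b * (√(2 * (b - a)) • head3 (XV q)) 2 = XV q 2
    rw [PiLp.smul_apply, smul_eq_mul, head3_apply_two, hci]
  · show rad a b (√(2 * (b - a)) • head3 (XV q)) * (uV q : EuclideanSpace ℝ (Fin 2)) 0 = XV q 3
    rw [hrad, coe_uV, baseVecV_apply_zero, ← mul_assoc, hs, one_mul]
  · show rad a b (√(2 * (b - a)) • head3 (XV q)) * (uV q : EuclideanSpace ℝ (Fin 2)) 1 = XV q 4
    rw [hrad, coe_uV, baseVecV_apply_one, ← mul_assoc, hs, one_mul]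

end BottModel

end Summit.SmoothPoincare4.SmoothPoincare4.Cruxes.RungOne.Sketch

end
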